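/-
Route `EguchiKawaiDirectionLadder` (ideator ym-idea-2, LINE 8) — THE TARGET FACT DISCHARGED (LEAD g24, unit ym-line-cbag-p1).
-/
import Summits.QuantumFields.YangMills.Theorems.EguchiKawaiDirectionLadderTripleSmallBallMargin
import Summits.QuantumFields.YangMills.Theorems.EguchiKawaiDirectionLadderBreakdownOfTripleMargin
import HarnessLib

/-!
# `EguchiKawaiBreakdown` holds

The barrier-ledger named fact `Literature.Barriers.QuantumFields.EguchiKawaiBreakdown` (centre-symmetry breaking of the naive
single-site Eguchi–Kawai reduction at weak coupling for every `d ≥ 3`, in the tree's small-ball formulation) is now a theorem: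
crux K_A `TripleSmallBallMargin` (`tripleSmallBallMargin_proof`, this unit) fed into
`eguchiKawaiBreakdown_of_tripleSmallBallMargin` (K_B `DirectionIncrement` + the route's Assembly, seats w2/w3).
HONEST FRAMING: this is the Eguchi–Kawai BREAKDOWN direction (a no-go / barrier fact); it proves no summit statement, no mass
gap, no continuum limit and no large-`N` reduction.
-/

namespace Summit.QuantumFields.YangMills.Theorems.EguchiKawaiDirectionLadder

/-- **The Eguchi–Kawai breakdown fact holds** (route target of `EguchiKawaiDirectionLadder`). -/
theorem EguchiKawaiBreakdown_holds : Literature.Barriers.QuantumFields.EguchiKawaiBreakdown :=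
  eguchiKawaiBreakdown_of_tripleSmallBallMargin tripleSmallBallMargin_proof

end Summit.QuantumFields.YangMills.Theorems.EguchiKawaiDirectionLadder
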